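import Literature.NumberTheory.Automorphic.ResGLnArchCoefficientModule
import Literature.Analysis.Matrix.DetExp
import Mathlib.Topology.Instances.Sign
import HarnessLib

/-!
# Sign twists `E_λ(ℂ) ⊗ ε_S` of the archimedean coefficient module of `Res_{K/ℚ} GL_n`
# (`ε_S = ∏_{w ∈ S} sgn det_w`, `S` a set of real places), as `(𝔤, K_∞)`-modules

Topic `NumberTheory/Automorphic`; namespaces `Literature.NumberTheory.Automorphic.RealMatrixGroup`
(generic part: sign-of-determinant characters of a linear real group) and
`Literature.NumberTheory.Automorphic.ResGLnCohomology` (the grouping namespace of the receptacle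
`ResGLnCohomology.levelCohomology k n K 𝔫 λ q = H^q(GL_n(K)⁺, Fun(GL_n(𝔸_K^∞)/K_f(𝔫), E_λ(k)))` and of
the named fact `ResGLnCohomology.cuspidalEigenclass_exists`).  Definitions with bodies and
theorems; no named fact, no instance, no `sorry`.

WHY.  The tree's relative Lie algebra cohomology `H^q(𝔤, K_∞; V)` (`GKCohomology`,
`AutomorphicRepCohomologyCoeff`, `CuspidalCohomologyArchCoeff`) is relative to the FULL maximal
compact subgroup `K_∞ = ∏_{w real} O(n) × ∏_{w complex} U(n)` of `G_∞ = GL_n(K_∞)`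
(`maximalCompact_archGroupGL_eq`), whereas the receptacle `levelCohomology` is the cohomology of
`S_{K_f} = GL_n(K)⁺\(X⁺ × GL_n(𝔸_K^∞)/K_f)`, i.e. of the quotient by the CONNECTED group
`K_∞° = ∏ SO(n) × ∏ U(n)` (the `(𝔤, K_∞°)`-cohomology of Clozel / Grobner–Raghuram).  Since
`H^q(𝔤, K_∞; V) = H^q(𝔤, K_∞°; V)^{π₀(K_∞)}`, `π₀(K_∞) = π₀(G_∞) = {±1}^{r₁}` (signs of `det` at the
real places), and `H^q(GL_n(K)⁺, M) = ⊕_ε H^q(GL_n(K), M ⊗ ε)` over the characters `ε` of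
`GL_n(K)/GL_n(K)⁺ ≅ {±1}^{r₁}`, the full receptacle is recovered from `(𝔤, K_∞)`-cohomology only
with ALL the sign twists `E_λ ⊗ ε_S` of the coefficients: at a real place where `π_w` has the
"odd" sign, `H^•(𝔤_w, O(n); π_w ⊗ E)` vanishes and one must twist by `sgn ∘ det`
[cite: Clozel1990, Lemme 3.14 (p. 120)] [cite: GrobnerRaghuram2014, §6, Rem. 27 (arXiv:1102.1872)];
already for `n = 1`, `K = ℚ`: an odd Dirichlet character contributes to
`H⁰(ℚ^×_{>0}, Fun(𝔸_f^×/K_f, ℂ))` but not to `H⁰(𝔤𝔩₁, O(1); 𝒜 ⊗ ℂ)`, only to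
`H⁰(𝔤𝔩₁, O(1); 𝒜 ⊗ sgn)`.  The twisted modules `E_λ ⊗ ε_S` restrict on `GL_n(K)⁺` to the SAME
Betti coefficients `ResGLnCohomology.coeffRepPos` as `E_λ` (a totally positive determinant has all
real signs `+1`), so each of them is a legitimate source for a comparison map to
`levelCohomology`.

WHAT (all proved):

* `RealMatrixGroup.signDetChar G φ : G →* ℂ`, `g ↦ sgn(φ(det g))` for a ring morphism
  `φ : A →+* ℝ` (`signDetChar_apply`); `signDetChar_sq` (values `±1`), `continuous_signDetChar`
  (for `φ` continuous: `det g ≠ 0` and `sgn` is locally constant off `0`), `signDetChar_expMem`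
  — **`sgn(φ(det exp X)) = 1`** (`det exp X = exp tr X`, `Literature.Analysis.Matrix.det_exp_eq_exp_trace`,
  and `φ(exp a) = e^{φ(a)} > 0`, `NormedSpace.map_exp`);
* `RealMatrixGroup.isDifferentiableRep_charRep_of_expMem` — a continuous character which is `1`
  on the one-parameter subgroups is a differentiable character with ZERO differential; hence
  `isDifferentiableRep_signDetChar` [cite: BorelWallach2000, 0 §2.3];
* `RealMatrixGroup.twistLie_zero` — twisting by a character with zero differential does not
  change the differential;
* `ResGLnCohomology.signChar n K S = ε_S = ∏_{w ∈ S} sgn det_w` on `G_∞ = GL_n(K_∞)`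
  (`S : Finset {w : InfinitePlace K // w.IsReal}`, `det_w` through `mixedSpaceEvalReal K w`),
  `signChar_apply`, `isDifferentiableRep_signChar`, `signChar_expMem`;
* `ResGLnCohomology.archCoeffRepSign n K λ S = E_λ(ℂ) ⊗ ε_S` (`RealMatrixGroup.twist` of
  `archCoeffRep n K λ`), `archCoeffRepSign_apply`, `isDifferentiableRep_archCoeffSign` (SAME
  differential `archCoeffLie n K λ`), `isGKModule_archCoeffSign` — **`E_λ ⊗ ε_S` is a
  `(𝔤, K_∞)`-module** [cite: BorelWallach2000, 0 §2.4–2.5];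
* `ResGLnCohomology.signDetChar_diagArch` — on `GL_n(K)` (`ParallelWeight.diagArch`) the factor at
  `w` is `sgn(w(det g))`; `signChar_diagArchPos` — **`ε_S = 1` on `GL_n(K)⁺`**
  (`mem_glTotPos_iff`); `archCoeffRepSign_diagArchPos` — **on `GL_n(K)⁺` every twist
  `E_λ ⊗ ε_S` is the Betti coefficient representation `coeffRepPos ℂ n K λ`** of
  `levelCohomology` (`archCoeffRep_diagArchPos`).

## Mathlib / Literature search

Mathlib: `SignType.sign`, `signHom`, `SignType.castHom`, `sign_pos`, `continuousAt_sign_of_ne_zero`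
(`Topology/Instances/Sign`), `NormedSpace.map_exp`, `Real.exp_pos`, `Matrix.GeneralLinearGroup.map/det`,
`NumberField.mixedEmbedding.mixedEmbedding_apply_isReal`, `InfinitePlace.embedding_of_isReal`.
Tree: `RealMatrixGroup.charRep/charLie/twist/twistLie/IsDifferentiableRep.twist/detChar`
(`GKModuleSubrepTwist`), `det_exp_eq_exp_trace` (`Literature.Analysis.Matrix.DetExp`),
`ResGLnCohomology.archCoeffRep/archCoeffLie/isDifferentiableRep_archCoeff/diagArchPos/
archCoeffRep_diagArchPos/finiteDimensional_coeffModule` (`ResGLnArchCoefficientModule`),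
`mixedSpaceEvalReal` (`AdelicGLnGlue`), `glTotPos/mem_glTotPos_iff` (`ResGLnCohomology`).
`lean search 'signDet|sign.*detChar|sgn.*det'` in `Literature/NumberTheory/Automorphic`: nothing prior.

## References

* L. Clozel, *Motifs et formes automorphes: applications du principe de fonctorialité*, in:
  Automorphic forms, Shimura varieties, and L-functions I (Ann Arbor 1988), Perspect. Math. 10,
  Academic Press 1990, Lemme 3.14 (p. 120). [Clozel1990]
* H. Grobner, A. Raghuram, Int. J. Number Theory 10 (2014) = arXiv:1102.1872, §6, Thm. 26 and
  Rem. 27 (`(𝔤, SO(n))`- versus `(𝔤, O(n))`-cohomology and the sign twist). [GrobnerRaghuram2014]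
* A. Borel, N. Wallach, *Continuous cohomology, discrete subgroups, and representations of
  reductive groups*, 2nd ed. (2000), 0 §2.3–2.5; I §5.1. [BorelWallach2000]
-/

noncomputable section

namespace Literature.NumberTheory.Automorphic

open Module

-- Mathlib idiom (as in `GKModules`): commutator bracket on `Module.End`
attribute [local instance 100] LieRing.ofAssociativeRing

open scoped MatrixGroups

/-! ### Sign-of-determinant characters of a linear real group -/

namespace RealMatrixGroup

section SignDet

open NormedSpace

variable {A : Type*} [NormedCommRing A] [NormedAlgebra ℝ A] [NormedAlgebra ℚ A] [CompleteSpace A]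
  [StarRing A] {N : Type*} [Fintype N] [DecidableEq N] (G : RealMatrixGroup A N)

/-- **The sign-of-determinant character `g ↦ sgn(φ(det g))`** of `G ≤ GL(N, A)` attached to a ring
morphism `φ : A →+* ℝ` (for `A = K_∞ = K ⊗ ℝ` and `φ` the coordinate at a real place `w`: the sign
of `det g_w`). [cite: GrobnerRaghuram2014, §6, Rem. 27] -/
def signDetChar (φ : A →+* ℝ) : G.carrier →* ℂ :=
  SignType.castHom.toMonoidHom.comp <|
    (signHom : ℝ →*₀ SignType).toMonoidHom.comp <|
      (Units.coeHom ℝ).comp <|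
        Matrix.GeneralLinearGroup.det.comp
          ((Matrix.GeneralLinearGroup.map φ).comp G.carrier.subtype)

/-- Unfolding: `signDetChar G φ g = sgn(φ(det g))`. [folklore] -/
theorem signDetChar_apply (φ : A →+* ℝ) (g : G.carrier) :
    signDetChar G φ g = ((SignType.sign (φ ((g : GL N A) : Matrix N N A).det) : SignType) : ℂ) := by
  show ((SignType.sign ((Matrix.GeneralLinearGroup.det
      (Matrix.GeneralLinearGroup.map φ (g : GL N A)) : ℝˣ) : ℝ) : SignType) : ℂ) = _
  rw [Matrix.GeneralLinearGroup.val_det_apply, RingHom.map_det]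
  rfl

/-- `φ(det g) ≠ 0` for `g ∈ G`. [folklore] -/
theorem map_det_ne_zero (φ : A →+* ℝ) (g : G.carrier) :
    φ ((g : GL N A) : Matrix N N A).det ≠ 0 := by
  rw [← Matrix.GeneralLinearGroup.val_det_apply]
  exact ((Matrix.GeneralLinearGroup.det (g : GL N A)).map (φ : A →* ℝ)).ne_zero

/-- The values of `signDetChar` are `±1`: `(sgn φ(det g))² = 1`. [folklore] -/
theorem signDetChar_sq (φ : A →+* ℝ) (g : G.carrier) : signDetChar G φ g ^ 2 = 1 := by
  rw [signDetChar_apply]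
  rcases (map_det_ne_zero G φ g).lt_or_gt with h | h
  · rw [sign_neg h]
    norm_num
  · rw [sign_pos h]
    norm_num

/-- **`signDetChar G φ` is continuous** for `φ` continuous (`det g ≠ 0` and `sgn` is locally
constant off `0`). [folklore] -/
theorem continuous_signDetChar {φ : A →+* ℝ} (hφ : Continuous φ) : Continuous (signDetChar G φ) := by
  have e : (signDetChar G φ : G.carrier → ℂ) =
      fun g : G.carrier => ((SignType.sign (φ ((g : GL N A) : Matrix N N A).det) : SignType) : ℂ) :=
    funext (signDetChar_apply G φ)
  rw [e]
  have hdet : Continuous fun g : G.carrier => φ ((g : GL N A) : Matrix N N A).det :=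
    hφ.comp (Units.continuous_val.comp continuous_subtype_val).matrix_det
  have hs : Continuous fun g : G.carrier => SignType.sign (φ ((g : GL N A) : Matrix N N A).det) :=
    continuous_iff_continuousAt.2 fun g =>
      (continuousAt_sign_of_ne_zero (map_det_ne_zero G φ g)).comp
        (f := fun g : G.carrier => φ ((g : GL N A) : Matrix N N A).det) hdet.continuousAt
  exact (continuous_of_discreteTopology (f := fun s : SignType => (s : ℂ))).comp hs

/-- **`sgn(φ(det exp X)) = 1`** on the one-parameter subgroups: `det (exp X) = exp (tr X)` and
`φ(exp a) = e^{φ(a)} > 0` for `φ` continuous. [folklore] -/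
theorem signDetChar_expMem {φ : A →+* ℝ} (hφ : Continuous φ) (X : G.lie) :
    signDetChar G φ (G.expMem X) = 1 := by
  rw [signDetChar_apply, coe_expMem, coe_expGL, Literature.Analysis.Matrix.det_exp_eq_exp_trace,
    NormedSpace.map_exp φ hφ, ← Real.exp_eq_exp_ℝ, sign_pos (Real.exp_pos _)]
  rfl

/-- **A continuous character which is `1` on the one-parameter subgroups is a differentiable
character with zero differential.** [cite: BorelWallach2000, 0 §2.3] -/
theorem isDifferentiableRep_charRep_of_expMem {c : G.carrier →* ℂ} (hc : Continuous c)
    (hexp : ∀ X : G.lie, c (G.expMem X) = 1) :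
    IsDifferentiableRep G (charRep G c) (charLie G 0) where
  continuous_coeff z ℓ := by
    have e : (fun g : G.carrier ↦ ℓ (charRep G c g z)) = fun g ↦ c g * ℓ z := by
      funext g
      rw [charRep_apply, ← smul_eq_mul, map_smul, smul_eq_mul]
    rw [e]
    exact hc.mul continuous_const
  hasDerivAt_coeff X z ℓ := by
    have e : (fun t : ℝ ↦ ℓ (charRep G c (G.expMem (t • X)) z)) = fun _ ↦ ℓ z := by
      funext t
      rw [charRep_apply, hexp, one_mul]
    rw [e, charLie_apply, LieHom.zero_apply, zero_mul, map_zero]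
    exact hasDerivAt_const 0 (ℓ z)

/-- **`signDetChar G φ` is a differentiable character with zero differential** (`φ` continuous).
[cite: BorelWallach2000, 0 §2.3] -/
theorem isDifferentiableRep_signDetChar {φ : A →+* ℝ} (hφ : Continuous φ) :
    IsDifferentiableRep G (charRep G (signDetChar G φ)) (charLie G 0) :=
  isDifferentiableRep_charRep_of_expMem G (continuous_signDetChar G hφ) (signDetChar_expMem G hφ)

/-- Twisting by a character with ZERO differential does not change the differential:
`twistLie G dτ 0 = dτ`. [folklore] -/
theorem twistLie_zero {E : Type*} [AddCommGroup E] [Module ℂ E]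
    (dτ : G.lie →ₗ⁅ℝ⁆ Module.End ℂ E) : twistLie G dτ 0 = dτ := by
  refine LieHom.ext fun X => LinearMap.ext fun v => ?_
  rw [twistLie_apply, LieHom.zero_apply, zero_smul, add_zero]

end SignDet

end RealMatrixGroup

/-! ### The sign characters `ε_S` of `GL_n(K_∞)` and the twists `E_λ ⊗ ε_S` -/

namespace ResGLnCohomology

open RealMatrixGroup ParallelWeight _root_.NumberField _root_.NumberField.InfinitePlace
  _root_.NumberField.mixedEmbedding
-- `Classical`: the place subtypes indexing `mixedSpace K` are `Fintype` classically (as in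
-- `AdelicGLnGlue` / `ResGLnArchCoefficientModule`); it also supplies `DecidableEq (K →+* ℂ)`.
open scoped MatrixGroups Classical

variable (n : ℕ) (K : Type) [Field K] [NumberField K]

omit [NumberField K] in
/-- Continuity of the real coordinate `mixedSpaceEvalReal K w : K_∞ → ℝ`. [folklore] -/
theorem continuous_mixedSpaceEvalReal (w : {w : InfinitePlace K // w.IsReal}) :
    Continuous (mixedSpaceEvalReal K w) :=
  (continuous_apply w).comp continuous_fst

/-- **The sign character `ε_S = ∏_{w ∈ S} sgn ∘ det_w` of `G_∞ = GL_n(K_∞)`** attached to a set `S`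
of real places of `K` (a character of `π₀(G_∞) = {±1}^{r₁}`). [cite: GrobnerRaghuram2014, §6, Rem. 27]
[cite: Clozel1990, Lemme 3.14 (p. 120)] -/
def signChar (S : Finset {w : InfinitePlace K // w.IsReal}) : (archGroupGL n K).carrier →* ℂ :=
  ∏ w ∈ S, signDetChar (archGroupGL n K) (mixedSpaceEvalReal K w)

variable (S : Finset {w : InfinitePlace K // w.IsReal})

/-- Unfolding: `ε_S(g) = ∏_{w ∈ S} sgn(det g_w)`. [folklore] -/
theorem signChar_apply (g : (archGroupGL n K).carrier) :
    signChar n K S g = ∏ w ∈ S, signDetChar (archGroupGL n K) (mixedSpaceEvalReal K w) g := by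
  rw [signChar, MonoidHom.finsetProd_apply]

/-- `ε_S = 1` on the one-parameter subgroups. [folklore] -/
theorem signChar_expMem (X : (archGroupGL n K).lie) : signChar n K S ((archGroupGL n K).expMem X) = 1 := by
  rw [signChar_apply]
  exact Finset.prod_eq_one fun w _ =>
    signDetChar_expMem (archGroupGL n K) (continuous_mixedSpaceEvalReal K w) X

/-- `ε_S` is continuous. [folklore] -/
theorem continuous_signChar : Continuous (signChar n K S) := by
  have e : (signChar n K S : (archGroupGL n K).carrier → ℂ) =
      fun g => ∏ w ∈ S, signDetChar (archGroupGL n K) (mixedSpaceEvalReal K w) g :=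
    funext (signChar_apply n K S)
  rw [e]
  exact continuous_finsetProd S fun w _ =>
    continuous_signDetChar (archGroupGL n K) (continuous_mixedSpaceEvalReal K w)

/-- **`ε_S` is a differentiable character of `G_∞` with zero differential.**
[cite: BorelWallach2000, 0 §2.3] -/
theorem isDifferentiableRep_signChar :
    IsDifferentiableRep (archGroupGL n K) (charRep (archGroupGL n K) (signChar n K S))
      (charLie (archGroupGL n K) 0) :=
  isDifferentiableRep_charRep_of_expMem (archGroupGL n K) (continuous_signChar n K S)
    (signChar_expMem n K S)

variable (lam : (K →+* ℂ) → Fin n → ℤ)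

/-- **The sign twist `E_λ(ℂ) ⊗ ε_S`** of the archimedean coefficient module: `g ↦ ε_S(g) E_λ(g)` on
`ResGLnCohomology.CoeffModule ℂ n K λ` (`RealMatrixGroup.twist` of `archCoeffRep n K λ`).
[cite: Clozel1990, Lemme 3.14 (p. 120)] [cite: GrobnerRaghuram2014, §6, Rem. 27] -/
def archCoeffRepSign : Representation ℂ (archGroupGL n K).carrier (CoeffModule ℂ n K lam) :=
  twist (archGroupGL n K) (archCoeffRep n K lam) (signChar n K S)

/-- Unfolding: `(E_λ ⊗ ε_S)(g) v = ε_S(g) • E_λ(g) v`. [folklore] -/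
@[simp]
theorem archCoeffRepSign_apply (g : (archGroupGL n K).carrier) (v : CoeffModule ℂ n K lam) :
    archCoeffRepSign n K S lam g v = signChar n K S g • archCoeffRep n K lam g v :=
  rfl

/-- **`E_λ ⊗ ε_S` is a differentiable representation of `G_∞` with the SAME (Leibniz)
differential `archCoeffLie n K λ` as `E_λ`** (the sign character has zero differential).
[cite: BorelWallach2000, 0 §2.3] -/
theorem isDifferentiableRep_archCoeffSign :
    IsDifferentiableRep (archGroupGL n K) (archCoeffRepSign n K S lam) (archCoeffLie n K lam) := by
  have h := (isDifferentiableRep_archCoeff n K lam).twist (isDifferentiableRep_signChar n K S)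
  rw [twistLie_zero] at h
  exact h

/-- **`E_λ ⊗ ε_S`, restricted to `K_∞`, is a `(𝔤, K_∞)`-module** — a coefficient module for
`H^•(𝔤, K_∞; π ⊗ (E_λ ⊗ ε_S))` (`AutomorphicRepCohomologyCoeff`). [cite: BorelWallach2000, 0 §2.4–2.5] -/
theorem isGKModule_archCoeffSign :
    IsGKModule (archGroupGL n K) (restrictK (archGroupGL n K) (archCoeffRepSign n K S lam))
      (archCoeffLie n K lam) := by
  haveI : FiniteDimensional ℂ (CoeffModule ℂ n K lam) := finiteDimensional_coeffModule n K lam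
  exact (isDifferentiableRep_archCoeffSign n K S lam).isGKModule

/-! #### Restriction to `GL_n(K)` and `GL_n(K)⁺` -/

/-- On `GL_n(K)` the factor of `ε_S` at the real place `w` is `sgn(w(det g))`. [folklore] -/
theorem signDetChar_diagArch (w : {w : InfinitePlace K // w.IsReal}) (g : GL (Fin n) K) :
    signDetChar (archGroupGL n K) (mixedSpaceEvalReal K w) (diagArch K n g) =
      ((SignType.sign (embedding_of_isReal w.2
        ((Matrix.GeneralLinearGroup.det g : Kˣ) : K)) : SignType) : ℂ) := by
  rw [signDetChar_apply, coe_diagArch]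
  congr 2
  change mixedSpaceEvalReal K w ((mixedEmbedding K).mapMatrix (g : Matrix (Fin n) (Fin n) K)).det = _
  rw [← RingHom.map_det, mixedSpaceEvalReal_apply, mixedEmbedding_apply_isReal,
    Matrix.GeneralLinearGroup.val_det_apply]

/-- **`ε_S = 1` on `GL_n(K)⁺`**: a totally positive determinant has sign `+1` at every real place.
[folklore] -/
theorem signChar_diagArchPos (γ : glTotPos n K) : signChar n K S (diagArchPos n K γ) = 1 := by
  rw [signChar_apply]
  refine Finset.prod_eq_one fun w _ => ?_
  rw [diagArchPos_apply, signDetChar_diagArch,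
    sign_pos ((mem_glTotPos_iff (γ : GL (Fin n) K)).mp γ.2 (embedding_of_isReal w.2))]
  rfl

/-- **On `GL_n(K)⁺` every sign twist `E_λ ⊗ ε_S` is the Betti coefficient representation
`ResGLnCohomology.coeffRepPos ℂ n K λ`** of `levelCohomology ℂ n K 𝔫 λ q` — so each
`H^•(𝔤, K_∞; 𝒜 ⊗ (E_λ ⊗ ε_S))` compares to the same `levelCohomology`. [cite: GrobnerRaghuram2014, §6–7]
[cite: Clozel1990, Lemme 3.14 and §3.5] -/
theorem archCoeffRepSign_diagArchPos (γ : glTotPos n K) :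
    archCoeffRepSign n K S lam (diagArchPos n K γ) = coeffRepPos ℂ n K lam γ := by
  refine LinearMap.ext fun v => ?_
  rw [archCoeffRepSign_apply, signChar_diagArchPos, one_smul, archCoeffRep_diagArchPos]

/-- For `S = ∅` the twist is `E_λ` itself. [folklore] -/
theorem archCoeffRepSign_empty : archCoeffRepSign n K ∅ lam = archCoeffRep n K lam := by
  refine MonoidHom.ext fun g => LinearMap.ext fun v => ?_
  rw [archCoeffRepSign_apply, signChar_apply, Finset.prod_empty, one_smul]

end ResGLnCohomology

end Literature.NumberTheory.Automorphic

end
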